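import Mathlib
import Summits.Ventures.HodgeRepro.Tier4.Common.CompactOpenLevel
import Summits.Ventures.HodgeRepro.Tier4.Common.LocalTorus
import Summits.Ventures.HodgeRepro.Tier4.Line4.ProjectedTest
import Summits.Ventures.HodgeRepro.Tier4.Line4.FinitePlacePositivity

/-!
# Tier4/Line4/LevelIndicatorAverage — the level average of `1_{γ K(N)}` does not vanish on `K(N) γ K(N)`

Blind re-derivation cell `pub-hodge-repro`, Tier 4 «prove the step» (README §9–§10), seat t4-L4-p2 (prover, LINE L4,
gen 3; self-cut on the PROJPROD side of plan-4's factorisation chain S14430 / S14443 — the `hF` input that L2-p3's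
FINSUPP (S14554) consumes for `F_f = biProj K(N) νK 1 (1_{γ₀,f K(N)})`). Tree path
`lean/Summits/Ventures/HodgeRepro/Tier4/Line4/LevelIndicatorAverage.lean`. Mathlib-level; no literature.

`biProj K νK 1 f y = ∫_K ∫_K f(κ⁻¹ y κ′)` (this seat's `Line4.biProj`, `ProjectedTest`). For `K = K(N)` (compact, open in
`G(𝔸_f)`: `Common.CompactOpenLevel`), `f = 1_{γ K}` with `γ ∈ G(𝔸_f)`, and `y = k₁ γ k₂ ∈ K γ K`, the inner integrand
is the constant `1_{K}(γ⁻¹ κ⁻¹ k₁ γ)`, so the average equals `νK(K) · νK{κ | γ⁻¹ κ⁻¹ k₁ γ ∈ K}`; the second set is open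
in `K` (the trace of `K` on `G(𝔸_f)` is open) and contains `k₁`, and a Haar measure is positive on non-empty open sets.

Nothing here says anything about the status of the Hodge conjecture for CM abelian varieties, which is NOT proved
(HC_CM is NOT proved by anyone in this repository).
-/

set_option autoImplicit false
noncomputable section
namespace Summit.Ventures.HodgeRepro.Tier4.Line4
open Summit.Ventures.HodgeRepro.Tier4 Summit.Ventures.HodgeRepro.Tier4.Common
  Summit.Ventures.HodgeRepro.Tier4.Line1 MeasureTheory
open scoped Pointwise

section LevelAverage
variable {k : Type} [Field k] [NumberField k] (W : PlaneData k) [MeasurableSpace (GA W)] [BorelSpace (GA W)]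

omit [MeasurableSpace (GA W)] [BorelSpace (GA W)] in
/-- Membership in the coset `{γ} * K`. -/
theorem mem_singleton_mul_coe_iff (K : Subgroup (GA W)) (γ x : GA W) :
    x ∈ ({γ} : Set (GA W)) * (K : Set (GA W)) ↔ γ⁻¹ * x ∈ K := by
  rw [Set.singleton_mul]
  constructor
  · rintro ⟨κ, hκ, rfl⟩
    simpa using hκ
  · intro h
    exact ⟨γ⁻¹ * x, h, by group⟩

omit [MeasurableSpace (GA W)] [BorelSpace (GA W)] in
/-- The trace of `K(N)` on a subgroup `K ≤ G(𝔸_f)`, pulled back along a continuous map into `G(𝔸_f)`, is open. -/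
theorem isOpen_preimage_levelK_of_continuous {N : ℕ} (hN : N ≠ 0) {X : Type} [TopologicalSpace X]
    {φ : X → GA W} (hφ : Continuous φ) (hfin : ∀ x, φ x ∈ finitePart W) :
    IsOpen {x : X | φ x ∈ levelK W N} := by
  have hφ' : Continuous fun x : X => (⟨φ x, hfin x⟩ : finitePart W) := hφ.subtype_mk hfin
  have hopen : IsOpen ((Subtype.val : finitePart W → GA W) ⁻¹' (levelK W N : Set (GA W))) := by
    rw [preimage_levelK_eq]
    exact (isOpen_finCongr W hN).preimage continuous_subtype_val
  exact hopen.preimage hφ'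

/-- **The level average of the indicator of `γ K(N)` is non-zero on `K(N) γ K(N)`** (`γ ∈ G(𝔸_f)`, `N ≠ 0`, `νK` a
Haar measure on `K(N)`). -/
theorem biProj_levelK_indicator_ne_zero {N : ℕ} (hN : N ≠ 0) (νK : Measure (levelK W N)) [νK.IsHaarMeasure]
    {γ : GA W} (hγ : γ ∈ finitePart W) {y : GA W} (hy : y ∈ levelDoubleCoset W N γ) :
    biProj (levelK W N) νK (fun _ => (1 : ℂ))
      (Set.indicator (({γ} : Set (GA W)) * (levelK W N : Set (GA W))) fun _ => (1 : ℂ)) y ≠ 0 := by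
  haveI : CompactSpace (levelK W N) := isCompact_iff_compactSpace.1 (isCompact_levelK W hN)
  -- the double-coset decomposition `y = k₁ γ k₂`
  obtain ⟨a, ha, k₂, hk₂, rfl⟩ := Set.mem_mul.1 hy
  obtain ⟨k₁, hk₁, c, hc, rfl⟩ := Set.mem_mul.1 ha
  rw [Set.mem_singleton_iff] at hc
  obtain rfl : γ = c := hc.symm
  have hk₁' : k₁ ∈ levelK W N := hk₁
  have hk₂' : k₂ ∈ levelK W N := hk₂
  -- the set of `κ` whose inner integrand is `1`
  set S : Set (levelK W N) := {κ | γ⁻¹ * (κ : GA W)⁻¹ * k₁ * γ ∈ levelK W N} with hS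
  have hSopen : IsOpen S := by
    refine isOpen_preimage_levelK_of_continuous W hN (φ := fun κ : levelK W N => γ⁻¹ * (κ : GA W)⁻¹ * k₁ * γ)
      ?_ ?_
    · exact ((continuous_const.mul continuous_subtype_val.inv).mul continuous_const).mul continuous_const
    · intro κ
      exact (finitePart W).mul_mem ((finitePart W).mul_mem ((finitePart W).mul_mem ((finitePart W).inv_mem hγ)
        ((finitePart W).inv_mem (levelK_le_finitePart W N κ.2))) (levelK_le_finitePart W N hk₁')) hγ
  have hSne : S.Nonempty := ⟨⟨k₁, hk₁'⟩, by
    show γ⁻¹ * k₁⁻¹ * k₁ * γ ∈ levelK W N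
    rw [inv_mul_cancel_right, inv_mul_cancel]
    exact (levelK W N).one_mem⟩
  -- the integrand, pointwise
  have hpt : ∀ κ κ' : levelK W N,
      Set.indicator (({γ} : Set (GA W)) * (levelK W N : Set (GA W))) (fun _ => (1 : ℂ))
        (((k₁ * γ * k₂)⁻¹ * (κ : GA W))⁻¹ * (κ' : GA W)) = S.indicator (fun _ => (1 : ℂ)) κ := by
    intro κ κ'
    have hmem : ((k₁ * γ * k₂)⁻¹ * (κ : GA W))⁻¹ * (κ' : GA W) ∈ ({γ} : Set (GA W)) * (levelK W N : Set (GA W)) ↔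
        κ ∈ S := by
      rw [mem_singleton_mul_coe_iff]
      have h : γ⁻¹ * (((k₁ * γ * k₂)⁻¹ * (κ : GA W))⁻¹ * (κ' : GA W)) =
          (γ⁻¹ * (κ : GA W)⁻¹ * k₁ * γ) * (k₂ * (κ' : GA W)) := by group
      rw [h]
      exact (levelK W N).mul_mem_cancel_right ((levelK W N).mul_mem hk₂' κ'.2)
    by_cases hκ : κ ∈ S
    · rw [Set.indicator_of_mem (hmem.2 hκ), Set.indicator_of_mem hκ]
    · rw [Set.indicator_of_notMem (fun h => hκ (hmem.1 h)), Set.indicator_of_notMem hκ]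
  -- the value of the average
  have hval : biProj (levelK W N) νK (fun _ => (1 : ℂ))
      (Set.indicator (({γ} : Set (GA W)) * (levelK W N : Set (GA W))) fun _ => (1 : ℂ)) (k₁ * γ * k₂) =
      (νK.real Set.univ * νK.real S : ℝ) := by
    have h1 : (starRingEnd ℂ) 1 = 1 := map_one _
    show (∫ κ : levelK W N, (starRingEnd ℂ) ((fun _ : GA W => (1 : ℂ)) κ) *
      (∫ κ' : levelK W N, (starRingEnd ℂ) ((starRingEnd ℂ) ((fun _ : GA W => (1 : ℂ)) κ')) *
        Set.indicator (({γ} : Set (GA W)) * (levelK W N : Set (GA W))) (fun _ => (1 : ℂ))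
          (((k₁ * γ * k₂)⁻¹ * (κ : GA W))⁻¹ * (κ' : GA W)) ∂νK) ∂νK) = _
    simp only [h1, one_mul, hpt, integral_const]
    rw [integral_smul, integral_indicator_const (1 : ℂ) hSopen.measurableSet, smul_smul, Complex.real_smul,
      mul_one]
  rw [hval]
  have hfin : (0 : ℝ) < νK.real Set.univ := by
    rw [measureReal_def]
    exact ENNReal.toReal_pos (isOpen_univ.measure_ne_zero νK Set.univ_nonempty) (measure_ne_top νK _)
  have hSpos : (0 : ℝ) < νK.real S := by
    rw [measureReal_def]
    exact ENNReal.toReal_pos (hSopen.measure_ne_zero νK hSne) (measure_ne_top νK _)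
  exact_mod_cast (mul_pos hfin hSpos).ne'

end LevelAverage

end Summit.Ventures.HodgeRepro.Tier4.Line4
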